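import Literature.Probability.RandomPlanarGeometry.HexSAWStripBridgeContactDensity
import Literature.Probability.Process.MatrixRenewalReward
import HarnessLib

/-!
# Pointwise contact density of long critical strip bridges: along every parity class the mean number of surface contacts of a
# critical bridge with exactly `n` steps is `θ_T · n + o(n)`; `θ₂ = (3 − √2)/4` (module «CONTACT-DENSITY-POINTWISE»)

Topic `Literature/Probability/RandomPlanarGeometry` (continues «CONTACT-DENSITY» `HexSAWStripBridgeContactDensity.lean` — the contact-weighted slices
`C_D(n)_{ab} = Σ_{bridges a→b, n steps} #top·x_c^n y^{#top}`, `C_M(n)` (irreducible), their derivative machinery `hasDerivAt_LUs/LMs`,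
`mul_derivSum_eq_contactSum`, the bound `contactSlice_le`, `summable_contactSlices`, `contactMoment_dotProduct_eq` (`C̄_M`-pairing `= y_T ⟨ℓ, M̄_top u⟩`),
and the ABELIAN density law `tendsto_contacts_per_step`; uses the tree's parity-shifted («hat») renewal pair of «LENGTH-POINTWISE-LAW»
`HexSAWStripBridgeLengthPointwiseLaw.lean` — `hatM/hatD`, `hat_ren`, `hatPair`, `hatPair_critical`, `hasSum_even_part/odd_part`, `chain_parity_even` — and the
abstract POINTWISE renewal–reward theorem of `Process/MatrixRenewalReward.lean` (`RenewalKernelPair.RewardPair.tendsto_S_div_D`, a-p2 g23)).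
Lane «pcv-sawmu» (CriticalPhenomena venture), a-p2 g23.  Sources of the SETTING: W. Feller I (1968) XIII.3 (periodic renewal sequences), XIII.11
(renewal–reward); H. Duminil-Copin, A. Hammond, CMP 324 (2013) §2.2; N. R. Beaton et al., CMP 326 (2014) Cor. 8 (`y_T`).  Nothing of the kind is printed
for the strip; the T = 2 value `(3 − √2)/4` is the lane's («AMPLITUDE-RATIO-WIDTH-TWO»).

## What is proved (namespace `Literature.Probability.RandomPlanarGeometry.SAW.HV`; `y_T = stripYT T`; hat length `n_k = hatLen k a b = 2k + χ_a − χ_b`;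
## `Ĉ_D(k)_{ab} := Σ_{l ∈ LUset T (2k+1) n_k a b} #top(l.tail)·wD T y l`, `Ĉ_M(k)` likewise over `LMset`; `D̂ = hatD`, `M̂ = hatM`)

* §1 ★★ `hat_contact_ren` — `Ĉ_D(k) = Ĉ_M(k) + Σ_{i+j=k}(Ĉ_M(i)D̂(j) + M̂(i)Ĉ_D(j))` for every `y > 0`: `y∂_y` of the tree's `hat_ren` (no parity bookkeeping
  beyond the tree's); `hat_contactSlices_eq` (hat slices = diagonal-truncation slices at `n_k⁺`).
* §2 `contactSlices_eq_zero_of_not_even` (parity), ★ `hasSum_hat_contactIrr` (`Σ_k Ĉ_M(k)_{ab} = Σ_n C_M(n)_{ab}` at `y_T`: the other parity vanishes),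
  `hat_contactSlices_facts` (`0 ≤ Ĉ_D(k) ≤ (2k+1)D̂(k)`, `0 ≤ Ĉ_M(k)`).
* §3 ★★★★ `tendsto_hat_contacts_div` (`T ≥ 2`; `u`, `ℓ` any positive fixed vectors of `Iinf T y_T`) — `Ĉ_D(k)_{ab}/((k+1)·D̂(k)_{ab}) → 2θ_T`,
  `θ_T = ⟨ℓ, C̄_M u⟩/⟨ℓ, M̄_len u⟩`, by `RewardPair.tendsto_S_div_D` for the reward pair `(Ĉ_M, Ĉ_D)` over the critical hat pair (`hatPair_critical` with the
  explicit residue `ρ = 1/⟨ℓ, M̄_len u⟩` of «AMPLITUDE-RATIO»); ★★★★ `tendsto_contacts_per_step_pointwise` — **`Ĉ_D(k)_{ab}/(n_k · D̂(k)_{ab}) → θ_T`**: the mean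
  number of surface contacts per step of a critical bridge `a → b` with exactly `n` steps converges to `θ_T` (the SAME constant as the Abelian law and as
  `Λℓ_T/(2Λ_T)`), for every pair of levels; ★★★ `widthTwo_contacts_per_step_pointwise` — `T = 2`: `→ (3 − √2)/4`, no hypotheses;
  ★★★ `tendsto_contacts_per_step_diag` — the diagonal form with the tree's plain slices: `C_D(2k)_{aa}/(2k·D(2k)_{aa}) → θ_T`.

Label: LANE THEOREM (own result of lane «pcv-sawmu», a-p2 g23, 2026-08-27); classical template = the renewal–reward theorem (Feller XIII.11) along
Feller's reduction of a periodic renewal sequence (XIII.3).  NOT claimed: a law of large numbers for the contacts of ONE long bridge (variance / concentration),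
β-walks or arches (heads and tails), `T = 1`, rates, anything uniform in `T`.
-/

noncomputable section

namespace Literature.Probability.RandomPlanarGeometry.SAW

open Finset Filter Topology Matrix BigOperators
open Literature.Analysis.Matrix Literature.Probability.Process

namespace HV

variable {T : ℕ}

/-! ### §1 The hat contact slices and their derived renewal equation (`y ∂_y` of `hat_ren`) -/

section Hat

/-- ★★ **The derived renewal equation along the parity classes.**  For `y > 0` and every `k`, with the hat contact slices
`Ĉ_D(k)_{ab} := Σ_{bridges a→b with 2k+χ_a−χ_b steps} #top · x_c^{|ω|} y^{#top}` and `Ĉ_M(k)` the same over irreducible bridges: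
`Ĉ_D(k) = Ĉ_M(k) + Σ_{i+j=k} (Ĉ_M(i) D̂(j) + M̂(i) Ĉ_D(j))` — `y ∂_y` applied to the tree's hat renewal equation `hat_ren` (an identity of
polynomials in `y` on `[0,∞)`); no parity bookkeeping is needed beyond the tree's. [cite: Feller1968, XIII.3 (periodic renewal sequences); DuminilCopinHammond2013, §2.2; lane «pcv-sawmu» a-p2 g23 — own] -/
theorem hat_contact_ren {y : ℝ} (hy : 0 < y) (k : ℕ) :
    (Matrix.of fun a b : Fin (2 * T) => ∑ l ∈ LUset T (2 * k + 1) (hatLen k a b) (a : ℕ) (b : ℕ), (topCnt T l.tail : ℝ) * wD T y l) =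
      (Matrix.of fun a b : Fin (2 * T) => ∑ l ∈ LMset T (2 * k + 1) (hatLen k a b) (a : ℕ) (b : ℕ), (topCnt T l.tail : ℝ) * wD T y l) +
        ∑ p ∈ antidiagonal k,
          ((Matrix.of fun a b : Fin (2 * T) => ∑ l ∈ LMset T (2 * p.1 + 1) (hatLen p.1 a b) (a : ℕ) (b : ℕ), (topCnt T l.tail : ℝ) * wD T y l) *
              hatD T y p.2 +
            hatM T y p.1 *
              (Matrix.of fun a b : Fin (2 * T) => ∑ l ∈ LUset T (2 * p.2 + 1) (hatLen p.2 a b) (a : ℕ) (b : ℕ), (topCnt T l.tail : ℝ) * wD T y l)) := by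
  ext a b
  -- derivative sums
  set dU : ℕ → Fin (2 * T) → Fin (2 * T) → ℝ → ℝ := fun k c d y =>
    ∑ l ∈ LUset T (2 * k + 1) (hatLen k c d) (c : ℕ) (d : ℕ), hexCriticalFugacity ^ (l.length - 1) * ((topCnt T l.tail : ℝ) * y ^ (topCnt T l.tail - 1))
    with hdU
  set dM : ℕ → Fin (2 * T) → Fin (2 * T) → ℝ → ℝ := fun k c d y =>
    ∑ l ∈ LMset T (2 * k + 1) (hatLen k c d) (c : ℕ) (d : ℕ), hexCriticalFugacity ^ (l.length - 1) * ((topCnt T l.tail : ℝ) * y ^ (topCnt T l.tail - 1))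
    with hdM
  have hF : HasDerivAt (fun y => hatD T y k a b) (dU k a b y) y := hasDerivAt_LUs (2 * k + 1) (hatLen k a b) _ _ y
  have hG : HasDerivAt (fun y => hatM T y k a b + ∑ p ∈ antidiagonal k, ∑ c : Fin (2 * T), hatM T y p.1 a c * hatD T y p.2 c b)
      (dM k a b y + ∑ p ∈ antidiagonal k, ∑ c : Fin (2 * T), (dM p.1 a c y * hatD T y p.2 c b + hatM T y p.1 a c * dU p.2 c b y)) y := by
    refine (hasDerivAt_LMs (2 * k + 1) (hatLen k a b) _ _ y).add (HasDerivAt.fun_sum fun p _ => HasDerivAt.fun_sum fun c _ => ?_)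
    exact (hasDerivAt_LMs (T := T) (2 * p.1 + 1) (hatLen p.1 a c) (a : ℕ) (c : ℕ) y).fun_mul
      (hasDerivAt_LUs (T := T) (2 * p.2 + 1) (hatLen p.2 c b) (c : ℕ) (b : ℕ) y)
  have hFG : (fun y => hatM T y k a b + ∑ p ∈ antidiagonal k, ∑ c : Fin (2 * T), hatM T y p.1 a c * hatD T y p.2 c b) =ᶠ[𝓝 y]
      (fun y => hatD T y k a b) := by
    filter_upwards [Ioi_mem_nhds hy] with y' hy'
    have h := congr_fun (congr_fun (hat_ren (T := T) (le_of_lt hy') k) a) b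
    rw [Matrix.add_apply, Matrix.sum_apply] at h
    rw [h]
    simp only [Matrix.mul_apply]
  have huniq := hF.unique (hG.congr_of_eventuallyEq hFG.symm)
  have hU : ∀ k (c d : Fin (2 * T)), y * dU k c d y =
      ∑ l ∈ LUset T (2 * k + 1) (hatLen k c d) (c : ℕ) (d : ℕ), (topCnt T l.tail : ℝ) * wD T y l :=
    fun k c d => mul_derivSum_eq_contactSum _ y
  have hM : ∀ k (c d : Fin (2 * T)), y * dM k c d y =
      ∑ l ∈ LMset T (2 * k + 1) (hatLen k c d) (c : ℕ) (d : ℕ), (topCnt T l.tail : ℝ) * wD T y l :=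
    fun k c d => mul_derivSum_eq_contactSum _ y
  rw [Matrix.add_apply, Matrix.sum_apply]
  simp only [Matrix.of_apply, Matrix.add_apply, Matrix.mul_apply]
  rw [← hU, ← hM, huniq, mul_add]
  congr 1
  rw [Finset.mul_sum (antidiagonal k)]
  refine sum_congr rfl fun p _ => ?_
  rw [Finset.mul_sum Finset.univ, ← sum_add_distrib]
  refine sum_congr rfl fun c _ => ?_
  rw [← hU, ← hM]
  ring

/-- The hat slices are the diagonal-truncation slices at the natural length `(2k + χ_a − χ_b)⁺` (and vanish at hat length `−1`):
truncation independence (plumbing). [cite: DuminilCopinHammond2013, §2.2; lane plumbing a-p2 g23] -/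
theorem hat_contactSlices_eq (y : ℝ) (k : ℕ) (a b : Fin (2 * T)) :
    (∑ l ∈ LUset T (2 * k + 1) (hatLen k a b) (a : ℕ) (b : ℕ), (topCnt T l.tail : ℝ) * wD T y l) =
        ∑ l ∈ LUset T (hatLen k a b).toNat (((hatLen k a b).toNat : ℕ) : ℤ) (a : ℕ) (b : ℕ), (topCnt T l.tail : ℝ) * wD T y l ∧
      (∑ l ∈ LMset T (2 * k + 1) (hatLen k a b) (a : ℕ) (b : ℕ), (topCnt T l.tail : ℝ) * wD T y l) =
        ∑ l ∈ LMset T (hatLen k a b).toNat (((hatLen k a b).toNat : ℕ) : ℤ) (a : ℕ) (b : ℕ), (topCnt T l.tail : ℝ) * wD T y l ∧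
      hatD T y k a b = LUM T (hatLen k a b).toNat (((hatLen k a b).toNat : ℕ) : ℤ) y a b ∧
      hatM T y k a b = LMM T (hatLen k a b).toNat (((hatLen k a b).toNat : ℕ) : ℤ) y a b := by
  have hχa := (lchi_facts a).1; have hχb := (lchi_facts b).1
  have hσ1 : hatLen k a b ≤ ((2 * k + 1 : ℕ) : ℤ) := by unfold hatLen; push_cast; omega
  by_cases hneg : hatLen k a b < 0
  · -- hat length `−1`: every slice is empty
    have hU0 : ∀ N, LUset T N (hatLen k a b) (a : ℕ) (b : ℕ) = ∅ := fun N => by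
      refine Finset.eq_empty_of_forall_notMem fun l hl => ?_
      obtain ⟨-, -, -, -, -, -, h2, -, -, hsz⟩ := of_mem_LUset hl
      unfold hlen at hsz; omega
    have hM0 : ∀ N, LMset T N (hatLen k a b) (a : ℕ) (b : ℕ) = ∅ := fun N => by
      refine Finset.eq_empty_of_forall_notMem fun l hl => ?_
      obtain ⟨-, -, -, -, -, -, -, h2, -, -, hsz⟩ := of_mem_LMset hl
      unfold hlen at hsz; omega
    have ht : (hatLen k a b).toNat = 0 := by omega
    have hU0' : LUset T 0 (0 : ℤ) (a : ℕ) (b : ℕ) = ∅ := by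
      refine Finset.eq_empty_of_forall_notMem fun l hl => ?_
      obtain ⟨-, -, -, -, -, -, h2, -, -, hsz⟩ := of_mem_LUset hl
      unfold hlen at hsz; omega
    have hM0' : LMset T 0 (0 : ℤ) (a : ℕ) (b : ℕ) = ∅ := by
      refine Finset.eq_empty_of_forall_notMem fun l hl => ?_
      obtain ⟨-, -, -, -, -, -, -, h2, -, -, hsz⟩ := of_mem_LMset hl
      unfold hlen at hsz; omega
    simp [ht, hatD, hatM, LUM, LUs, LMM, LMs, hU0, hM0, hU0', hM0']
  · have hσ : (((hatLen k a b).toNat : ℕ) : ℤ) = hatLen k a b := by omega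
    rw [hσ]
    have hle : hatLen k a b ≤ (((hatLen k a b).toNat : ℕ) : ℤ) := by omega
    obtain ⟨hUe, hMe⟩ := LUM_LMM_eq_of_le (T := T) hσ1 hle y
    refine ⟨by rw [LUset_eq_of_le hσ1 hle], by rw [LMset_eq_of_le hσ1 hle], ?_, ?_⟩
    · rw [hatD, hUe]
    · rw [hatM, hMe]

end Hat

/-! ### §2 Summability of the hat contact slices at the threshold; the parity-class sums of `Ĉ_M` -/

section Threshold

/-- Parity: the contact slices `C_D(n)_{ab}`, `C_M(n)_{ab}` vanish unless `n ≡ a + b (mod 2)` (a bridge `a → b` with `n` steps has `n ≡ b − a`;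
plumbing). [cite: DuminilCopinSmirnov2012, §3; DuminilCopinHammond2013, §2.2; lane plumbing a-p2 g23] -/
theorem contactSlices_eq_zero_of_not_even {N : ℕ} {σ : ℤ} (y : ℝ) (a b : Fin (2 * T)) (h : ¬ Even (σ + (a : ℕ) + (b : ℕ))) :
    (∑ l ∈ LUset T N σ (a : ℕ) (b : ℕ), (topCnt T l.tail : ℝ) * wD T y l) = 0 ∧
      (∑ l ∈ LMset T N σ (a : ℕ) (b : ℕ), (topCnt T l.tail : ℝ) * wD T y l) = 0 := by
  have key : ∀ {q : List HV}, q.IsChain hvGraph.Adj → 2 ≤ q.length → hdLev q = ((a : ℕ) : ℤ) → ltLev q = ((b : ℕ) : ℤ) →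
      hlen q = σ → False := by
    intro q hc h2 ha hb hsz
    have hne : q ≠ [] := by rintro rfl; simp at h2
    obtain ⟨k, hk⟩ := chain_parity_even hc hne
    rw [ha, hb, hsz] at hk
    exact h ⟨((b : ℕ) : ℤ) - k, by omega⟩
  constructor
  · refine sum_eq_zero fun q hq => ?_
    obtain ⟨hc, -, -, -, -, -, h2, ha, hb, hsz⟩ := of_mem_LUset hq
    exact (key hc h2 ha hb hsz).elim
  · refine sum_eq_zero fun q hq => ?_
    obtain ⟨hc, -, -, -, -, -, -, h2, ha, hb, hsz⟩ := of_mem_LMset hq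
    exact (key hc h2 ha hb hsz).elim

/-- ★ **The parity-class sum of the irreducible contact slices is the full sum**: `Σ_k Ĉ_M(k)_{ab} = Σ_n C_M(n)_{ab} = C̄_{M,ab}` at `y_T` (the
slices of the other parity vanish; `T ≥ 2`). [cite: Feller1968, XIII.3 (periodic renewal sequences); lane «pcv-sawmu» a-p2 g23] -/
theorem hasSum_hat_contactIrr (hT : 2 ≤ T) (a b : Fin (2 * T)) :
    HasSum (fun k : ℕ => ∑ l ∈ LMset T (2 * k + 1) (hatLen k a b) (a : ℕ) (b : ℕ), (topCnt T l.tail : ℝ) * wD T (stripYT T) l)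
      (∑' n : ℕ, ∑ l ∈ LMset T n (n : ℤ) (a : ℕ) (b : ℕ), (topCnt T l.tail : ℝ) * wD T (stripYT T) l) := by
  set f : ℕ → ℝ := fun n => ∑ l ∈ LMset T n (n : ℤ) (a : ℕ) (b : ℕ), (topCnt T l.tail : ℝ) * wD T (stripYT T) l with hf
  have hfs : HasSum f (∑' n, f n) := (summable_contactSlices hT a b le_rfl zero_lt_one).2.2.hasSum
  have hχa := (lchi_facts a).1; have hχb := (lchi_facts b).1
  obtain ⟨ja, hja⟩ := (lchi_facts a).2
  obtain ⟨jb, hjb⟩ := (lchi_facts b).2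
  -- the hat slice equals `f ((hatLen k a b).toNat)`
  have hk : ∀ k, (∑ l ∈ LMset T (2 * k + 1) (hatLen k a b) (a : ℕ) (b : ℕ), (topCnt T l.tail : ℝ) * wD T (stripYT T) l) =
      f (hatLen k a b).toNat := fun k => (hat_contactSlices_eq (stripYT T) k a b).2.1
  simp_rw [hk]
  -- parity vanishing of `f`
  have hvan : ∀ n : ℕ, ¬ Even ((n : ℤ) + (a : ℕ) + (b : ℕ)) → f n = 0 := fun n hn =>
    (contactSlices_eq_zero_of_not_even (stripYT T) a b hn).2
  rcases lt_trichotomy (lchi a) (lchi b) with hlt | heq | hgt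
  · -- `χ_a = 0`, `χ_b = 1`: hat lengths `−1, 1, 3, …`; odd part with a shift
    have h0 : lchi a = 0 := by omega
    have h1 : lchi b = 1 := by omega
    have hodd := hasSum_odd_part hfs (fun k => hvan (2 * k) (by rintro ⟨m, hm⟩; omega))
    have hshape : (fun k : ℕ => f (hatLen k a b).toNat) = fun k : ℕ => if k = 0 then 0 else f (2 * (k - 1) + 1) := by
      funext k
      rcases Nat.eq_zero_or_pos k with rfl | hkp
      · simp only [if_true]
        have : (hatLen 0 a b).toNat = 0 := by unfold hatLen; omega
        rw [this]
        exact hvan 0 (by rintro ⟨m, hm⟩; omega)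
      · rw [if_neg (by omega)]
        congr 1
        unfold hatLen; omega
    rw [hshape]
    -- `Σ_k g(k)` with `g 0 = 0`, `g (j+1) = f(2j+1)`
    refine (hasSum_nat_add_iff' 1).1 ?_
    have hg1 : (fun n : ℕ => if n + 1 = 0 then (0 : ℝ) else f (2 * (n + 1 - 1) + 1)) = fun n => f (2 * n + 1) := by
      funext n; rw [if_neg (by omega)]; simp
    rw [sum_range_one, if_pos rfl, sub_zero, hg1]
    exact hodd
  · -- `χ_a = χ_b`: even part
    have heven := hasSum_even_part hfs (fun k => hvan (2 * k + 1) (by rintro ⟨m, hm⟩; omega))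
    have hg : (fun k : ℕ => f (hatLen k a b).toNat) = fun k => f (2 * k) := by
      funext k; congr 1; unfold hatLen; omega
    rw [hg]; exact heven
  · -- `χ_a = 1`, `χ_b = 0`: odd part
    have hodd := hasSum_odd_part hfs (fun k => hvan (2 * k) (by rintro ⟨m, hm⟩; omega))
    have hg : (fun k : ℕ => f (hatLen k a b).toNat) = fun k => f (2 * k + 1) := by
      funext k; congr 1; unfold hatLen; omega
    rw [hg]; exact hodd

/-- Summability of the hat irreducible contact slices at `y_T` and the bound `0 ≤ Ĉ_D(k) ≤ (2k+1)·D̂(k)` (plumbing for the reward pair).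
[cite: DuminilCopinHammond2013, §2.2; lane plumbing a-p2 g23] -/
theorem hat_contactSlices_facts (hT : 2 ≤ T) (k : ℕ) (a b : Fin (2 * T)) :
    (0 ≤ ∑ l ∈ LUset T (2 * k + 1) (hatLen k a b) (a : ℕ) (b : ℕ), (topCnt T l.tail : ℝ) * wD T (stripYT T) l ∧
      ∑ l ∈ LUset T (2 * k + 1) (hatLen k a b) (a : ℕ) (b : ℕ), (topCnt T l.tail : ℝ) * wD T (stripYT T) l ≤
        (2 * k + 1) * hatD T (stripYT T) k a b) ∧
      0 ≤ ∑ l ∈ LMset T (2 * k + 1) (hatLen k a b) (a : ℕ) (b : ℕ), (topCnt T l.tail : ℝ) * wD T (stripYT T) l := by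
  have hy := (stripYT_pos (show 1 ≤ T by omega)).le
  obtain ⟨hU, hM, hD, -⟩ := hat_contactSlices_eq (stripYT T) k a b
  have hb := contactSlice_le (T := T) hy (hatLen k a b).toNat a b
  have hχa := (lchi_facts a).1; have hχb := (lchi_facts b).1
  have hn : (((hatLen k a b).toNat : ℕ) : ℝ) ≤ 2 * k + 1 := by
    have : (hatLen k a b).toNat ≤ 2 * k + 1 := by unfold hatLen; omega
    exact_mod_cast this
  rw [hU, hM, hD]
  exact ⟨⟨hb.1.1, hb.1.2.trans (mul_le_mul_of_nonneg_right hn (LMM_LUM_nonneg hy _ a b).2)⟩, hb.2.1⟩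

end Threshold

/-! ### §3 The pointwise contact density -/

section Pointwise

variable {u ℓ : Fin (2 * T) → ℝ}

/-- ★★★★ **THE POINTWISE CONTACT DENSITY OF LONG CRITICAL BRIDGES** (`T ≥ 2`).  For all levels `a, b`, along the parity class
`n_k = 2k + χ_a − χ_b` of the lengths of the bridges `a → b`,
`Ĉ_D(k)_{ab} / ((k+1) · D̂(k)_{ab}) ⟶ 2 θ_T`,  `θ_T = ⟨ℓ, C̄_M u⟩ / ⟨ℓ, M̄_len u⟩`
(`Ĉ_D(k)_{ab} = Σ_{bridges a→b, n_k steps} #top · x_c^{n_k} y_T^{#top}`, `D̂(k)_{ab}` the same without `#top`; `u`, `ℓ` any positive fixed vectors of the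
critical kernel; `C̄_M = Σ_n C_M(n) = y_T M̄_top`): the MEAN NUMBER OF SURFACE CONTACTS of a critical bridge with exactly `n` steps is `θ_T · n + o(n)` —
the pointwise form of «CONTACT-DENSITY»'s Abelian law, by the abstract pointwise renewal–reward theorem (`Process/MatrixRenewalReward`,
`RewardPair.tendsto_S_div_D`) applied to the tree's critical hat pair (`hatPair_critical`) with the reward pair of §1–§2.  For `T = 2`, `θ₂ = (3 − √2)/4`.
[cite: Feller1968, XIII.11 (renewal–reward theorem); DuminilCopinHammond2013, §2.2; BeatonBousquetMelouDeGierDuminilCopinGuttmann2014, Cor. 8 (y_T); lane «pcv-sawmu» a-p2 g23 — own result] -/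
theorem tendsto_hat_contacts_div (hT : 2 ≤ T) (hu0 : ∀ a, 0 < u a) (hℓ0 : ∀ b, 0 < ℓ b)
    (hu : Iinf T (stripYT T) *ᵥ u = u) (hℓ : ℓ ᵥ* Iinf T (stripYT T) = ℓ) (a b : Fin (2 * T)) :
    Tendsto (fun k : ℕ => (∑ l ∈ LUset T (2 * k + 1) (hatLen k a b) (a : ℕ) (b : ℕ), (topCnt T l.tail : ℝ) * wD T (stripYT T) l) /
        ((k + 1) * hatD T (stripYT T) k a b)) atTop
      (𝓝 (2 * ((ℓ ⬝ᵥ ((Matrix.of fun c d : Fin (2 * T) =>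
          ∑' n : ℕ, ∑ l ∈ LMset T n (n : ℤ) (c : ℕ) (d : ℕ), (topCnt T l.tail : ℝ) * wD T (stripYT T) l) *ᵥ u)) /
        (ℓ ⬝ᵥ ((Matrix.of fun a b : Fin (2 * T) => ∑' n : ℕ, (n : ℝ) * LMM T n (n : ℤ) (stripYT T) a b) *ᵥ u))))) := by
  have hT1 : 1 ≤ T := by omega
  have hyT : 0 < stripYT T := stripYT_pos hT1
  obtain ⟨hl, hL⟩ := tendsto_stripLenD_residue_explicit hT hu0 hℓ0 hu hℓ
  set dl := ℓ ⬝ᵥ ((Matrix.of fun a b : Fin (2 * T) => ∑' n : ℕ, (n : ℝ) * LMM T n (n : ℤ) (stripYT T) a b) *ᵥ u) with hdl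
  -- the critical hat pair with `ρ = 1/dl`
  have hres : ∀ a b, Tendsto (fun s : ℝ => (1 - s) * stripLenD T s a b) (𝓝[<] 1) (𝓝 (1 / dl * (u a * ℓ b))) := fun a b => by
    have := hL a b; rwa [show u a * ℓ b / dl = 1 / dl * (u a * ℓ b) by ring] at this
  have hcrit := hatPair_critical hT hu0 hℓ0 (one_div_pos.2 hl) hres
  set K := hatPair T hyT.le with hK
  -- the reward pair
  let W : RenewalKernelPair.RewardPair K :=
    { R := fun k => Matrix.of fun a b : Fin (2 * T) =>
        ∑ l ∈ LMset T (2 * k + 1) (hatLen k a b) (a : ℕ) (b : ℕ), (topCnt T l.tail : ℝ) * wD T (stripYT T) l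
      S := fun k => Matrix.of fun a b : Fin (2 * T) =>
        ∑ l ∈ LUset T (2 * k + 1) (hatLen k a b) (a : ℕ) (b : ℕ), (topCnt T l.tail : ℝ) * wD T (stripYT T) l
      R_nonneg := fun k a b => (hat_contactSlices_facts hT k a b).2
      S_nonneg := fun k a b => (hat_contactSlices_facts hT k a b).1.1
      ren := fun k => hat_contact_ren hyT k
      summable_R := fun a b => (hasSum_hat_contactIrr hT a b).summable
      summable_S := fun a b s hs0 hs1 => by
        -- `Ĉ_D(k) ≤ (2k+1) D̂(k) ≤ (2k+1) B`
        obtain ⟨B, hB⟩ := (K.tendsto_coeff hcrit a b).bddAbove_range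
        have hB' : ∀ k, hatD T (stripYT T) k a b ≤ B := fun k => hB ⟨k, rfl⟩
        have hB0 : 0 ≤ B := (LMM_LUM_nonneg hyT.le _ a b).2.trans (hB' 0)
        have hg : Summable fun k : ℕ => (2 * k + 1) * B * s ^ k := by
          have h1 : Summable fun k : ℕ => (k : ℝ) * s ^ k := by
            have := summable_pow_mul_geometric_of_norm_lt_one 1 (show ‖s‖ < 1 by rw [Real.norm_eq_abs, abs_of_nonneg hs0]; exact hs1)
            simpa using this
          have h2 : Summable fun k : ℕ => s ^ k := summable_geometric_of_lt_one hs0 hs1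
          have : (fun k : ℕ => (2 * k + 1) * B * s ^ k) = fun k : ℕ => 2 * B * ((k : ℝ) * s ^ k) + B * s ^ k := by
            funext k; ring
          rw [this]
          exact (h1.mul_left _).add (h2.mul_left _)
        refine hg.of_nonneg_of_le (fun k => mul_nonneg (hat_contactSlices_facts hT k a b).1.1 (pow_nonneg hs0 _)) fun k => ?_
        simp only [Matrix.of_apply]
        refine mul_le_mul_of_nonneg_right ?_ (pow_nonneg hs0 _)
        exact (hat_contactSlices_facts hT k a b).1.2.trans (mul_le_mul_of_nonneg_left (hB' k) (by positivity)) }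
  have hmain := W.tendsto_S_div_D hcrit a a b
  -- identify the constant
  have hR : ∀ c d : Fin (2 * T), ∑' j : ℕ, W.R j c d =
      ∑' n : ℕ, ∑ l ∈ LMset T n (n : ℤ) (c : ℕ) (d : ℕ), (topCnt T l.tail : ℝ) * wD T (stripYT T) l := fun c d =>
    (hasSum_hat_contactIrr hT c d).tsum_eq
  set CM := (Matrix.of fun c d : Fin (2 * T) =>
    ∑' n : ℕ, ∑ l ∈ LMset T n (n : ℤ) (c : ℕ) (d : ℕ), (topCnt T l.tail : ℝ) * wD T (stripYT T) l) with hCM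
  have hval : (∑ d, (∑ c, 2 * (1 / dl * (u a * ℓ c)) * ∑' j : ℕ, W.R j c d) * (2 * (1 / dl * (u d * ℓ a)))) /
      (2 * (1 / dl * (u a * ℓ a))) = 2 * ((ℓ ⬝ᵥ (CM *ᵥ u)) / dl) := by
    simp_rw [hR]
    have hne : 2 * (1 / dl * (u a * ℓ a)) ≠ 0 := by have := hu0 a; have := hℓ0 a; positivity
    rw [div_eq_iff hne]
    simp only [Matrix.mulVec, dotProduct, hCM, Matrix.of_apply, div_eq_mul_inv, sum_mul, mul_sum]
    rw [Finset.sum_comm]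
    refine sum_congr rfl fun c _ => sum_congr rfl fun d _ => ?_
    have hdl0 : dl ≠ 0 := hl.ne'
    field_simp
  rw [hval] at hmain
  exact hmain

/-- `(k+1)/(2k + χ_a − χ_b) → 1/2` (plumbing: the hat index counts half the length). [folklore] -/
private theorem tendsto_succ_div_hatLen (a b : Fin (2 * T)) :
    Tendsto (fun k : ℕ => ((k : ℝ) + 1) / (hatLen k a b : ℝ)) atTop (𝓝 (1 / 2)) := by
  set e : ℤ := lchi a - lchi b with he
  have hL : ∀ k : ℕ, (hatLen k a b : ℝ) = 2 * (k : ℝ) + (e : ℝ) := fun k => by unfold hatLen; push_cast; rw [he]; push_cast; ring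
  have hden : Tendsto (fun k : ℕ => 2 * (k : ℝ) + (e : ℝ)) atTop atTop :=
    (tendsto_natCast_atTop_atTop.const_mul_atTop two_pos).atTop_add tendsto_const_nhds
  have hsmall : Tendsto (fun k : ℕ => (1 - (e : ℝ) / 2) / (2 * (k : ℝ) + (e : ℝ))) atTop (𝓝 0) :=
    tendsto_const_nhds.div_atTop hden
  have hlim : Tendsto (fun k : ℕ => 1 / 2 + (1 - (e : ℝ) / 2) / (2 * (k : ℝ) + (e : ℝ))) atTop (𝓝 (1 / 2 + 0)) :=
    tendsto_const_nhds.add hsmall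
  rw [add_zero] at hlim
  refine hlim.congr' ?_
  filter_upwards [hden.eventually_gt_atTop 0] with k hk
  rw [hL k]
  field_simp
  ring

/-- ★★★★ **CONTACTS PER STEP, POINTWISE** (`T ≥ 2`): for all levels `a, b`, along the lengths `n_k = 2k + χ_a − χ_b` of the bridges `a → b`,
`Ĉ_D(k)_{ab} / (n_k · D̂(k)_{ab}) ⟶ θ_T = ⟨ℓ, C̄_M u⟩/⟨ℓ, M̄_len u⟩`
— the mean number of surface contacts PER STEP of a critical bridge with exactly `n` steps tends to `θ_T`, for every pair of levels (the same `θ_T` as in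
the Abelian law `tendsto_contacts_per_step` and in `Λℓ_T = 2Λ_T θ_T`). [cite: Feller1968, XIII.11; DuminilCopinHammond2013, §2.2; lane «pcv-sawmu» a-p2 g23 — own result] -/
theorem tendsto_contacts_per_step_pointwise (hT : 2 ≤ T) (hu0 : ∀ a, 0 < u a) (hℓ0 : ∀ b, 0 < ℓ b)
    (hu : Iinf T (stripYT T) *ᵥ u = u) (hℓ : ℓ ᵥ* Iinf T (stripYT T) = ℓ) (a b : Fin (2 * T)) :
    Tendsto (fun k : ℕ => (∑ l ∈ LUset T (2 * k + 1) (hatLen k a b) (a : ℕ) (b : ℕ), (topCnt T l.tail : ℝ) * wD T (stripYT T) l) /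
        ((hatLen k a b : ℝ) * hatD T (stripYT T) k a b)) atTop
      (𝓝 ((ℓ ⬝ᵥ ((Matrix.of fun c d : Fin (2 * T) =>
          ∑' n : ℕ, ∑ l ∈ LMset T n (n : ℤ) (c : ℕ) (d : ℕ), (topCnt T l.tail : ℝ) * wD T (stripYT T) l) *ᵥ u)) /
        (ℓ ⬝ᵥ ((Matrix.of fun a b : Fin (2 * T) => ∑' n : ℕ, (n : ℝ) * LMM T n (n : ℤ) (stripYT T) a b) *ᵥ u)))) := by
  have h1 := tendsto_hat_contacts_div hT hu0 hℓ0 hu hℓ a b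
  have h2 := tendsto_succ_div_hatLen (T := T) a b
  have h := h1.mul h2
  rw [show 2 * ((ℓ ⬝ᵥ ((Matrix.of fun c d : Fin (2 * T) =>
      ∑' n : ℕ, ∑ l ∈ LMset T n (n : ℤ) (c : ℕ) (d : ℕ), (topCnt T l.tail : ℝ) * wD T (stripYT T) l) *ᵥ u)) /
      (ℓ ⬝ᵥ ((Matrix.of fun a b : Fin (2 * T) => ∑' n : ℕ, (n : ℝ) * LMM T n (n : ℤ) (stripYT T) a b) *ᵥ u))) * (1 / 2) =
      (ℓ ⬝ᵥ ((Matrix.of fun c d : Fin (2 * T) =>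
        ∑' n : ℕ, ∑ l ∈ LMset T n (n : ℤ) (c : ℕ) (d : ℕ), (topCnt T l.tail : ℝ) * wD T (stripYT T) l) *ᵥ u)) /
      (ℓ ⬝ᵥ ((Matrix.of fun a b : Fin (2 * T) => ∑' n : ℕ, (n : ℝ) * LMM T n (n : ℤ) (stripYT T) a b) *ᵥ u)) by ring] at h
  refine h.congr' ?_
  have hden : Tendsto (fun k : ℕ => (hatLen k a b : ℝ)) atTop atTop := by
    have hL : ∀ k : ℕ, (hatLen k a b : ℝ) = 2 * (k : ℝ) + ((lchi a - lchi b : ℤ) : ℝ) := fun k => by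
      unfold hatLen; push_cast; ring
    simp_rw [hL]
    exact (tendsto_natCast_atTop_atTop.const_mul_atTop two_pos).atTop_add tendsto_const_nhds
  filter_upwards [hden.eventually_gt_atTop 0] with k hk
  have hk1 : (k : ℝ) + 1 ≠ 0 := by positivity
  by_cases hD : hatD T (stripYT T) k a b = 0
  · simp [hD]
  · field_simp

/-- ★★★ **Width two, pointwise: `(3 − √2)/4` contacts per step.**  For every pair of levels `a, b` of `S₂`, along `n_k = 2k + χ_a − χ_b`:
`Ĉ_D(k)_{ab}/(n_k · D̂(k)_{ab}) → (3 − √2)/4 = 0.39644…` — no hypotheses (the tree's `y₂`, `Λ₂`, `Λℓ₂`; «AMPLITUDE-RATIO-WIDTH-TWO»).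
[cite: BeatonBousquetMelouDeGierDuminilCopinGuttmann2014, Cor. 8 (y₂); Feller1968, XIII.11; lane «pcv-sawmu» a-p2 g23 — own result] -/
theorem widthTwo_contacts_per_step_pointwise (a b : Fin (2 * 2)) :
    Tendsto (fun k : ℕ => (∑ l ∈ LUset 2 (2 * k + 1) (hatLen k a b) (a : ℕ) (b : ℕ), (topCnt 2 l.tail : ℝ) * wD 2 (stripYT 2) l) /
        ((hatLen k a b : ℝ) * hatD 2 (stripYT 2) k a b)) atTop (𝓝 ((3 - Real.sqrt 2) / 4)) := by
  have hT : 2 ≤ 2 := le_rfl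
  obtain ⟨u, ℓ, hu0, hℓ0, hu, hℓ⟩ := exists_pos_fixed_vectors_Iinf_stripYT hT
  have h := tendsto_contacts_per_step_pointwise hT hu0 hℓ0 hu hℓ a b
  rw [contactMoment_dotProduct_eq hT u ℓ] at h
  have hW := widthTwo_meanContacts_per_step hu0 hℓ0 hu hℓ
  obtain ⟨hl, -⟩ := tendsto_stripLenD_residue_explicit hT hu0 hℓ0 hu hℓ
  set dl := ℓ ⬝ᵥ ((Matrix.of fun a b : Fin (2 * 2) => ∑' n : ℕ, (n : ℝ) * LMM 2 n (n : ℤ) (stripYT 2) a b) *ᵥ u) with hdl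
  set dc := ℓ ⬝ᵥ ((Matrix.of fun a b : Fin (2 * 2) => ∑' j : ℕ, (j : ℝ) * irCoeff 2 j a b * stripYT 2 ^ (j - 1)) *ᵥ u) with hdc
  have hval : stripYT 2 * dc / dl = (3 - Real.sqrt 2) / 4 := by
    rw [div_eq_div_iff hl.ne' (by norm_num : (4 : ℝ) ≠ 0)]
    linarith [hW]
  rwa [hval] at h

/-- ★★★ **Diagonal form (even lengths, same level)**: for every level `a`, with the tree's diagonal-truncation slices,
`C_D(2k)_{aa} / (2k · D(2k)_{aa}) ⟶ θ_T` — the mean number of surface contacts per step of a critical bridge from level `a` back to level `a`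
with exactly `2k` steps tends to `θ_T = ⟨ℓ, C̄_M u⟩/⟨ℓ, M̄_len u⟩` (`T ≥ 2`; the case `a = b` of `tendsto_contacts_per_step_pointwise`, where `n_k = 2k`).
[cite: Feller1968, XIII.11; DuminilCopinHammond2013, §2.2; lane «pcv-sawmu» a-p2 g23 — own result] -/
theorem tendsto_contacts_per_step_diag (hT : 2 ≤ T) (hu0 : ∀ a, 0 < u a) (hℓ0 : ∀ b, 0 < ℓ b)
    (hu : Iinf T (stripYT T) *ᵥ u = u) (hℓ : ℓ ᵥ* Iinf T (stripYT T) = ℓ) (a : Fin (2 * T)) :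
    Tendsto (fun k : ℕ => (∑ l ∈ LUset T (2 * k) ((2 * k : ℕ) : ℤ) (a : ℕ) (a : ℕ), (topCnt T l.tail : ℝ) * wD T (stripYT T) l) /
        ((2 * k : ℕ) * LUM T (2 * k) ((2 * k : ℕ) : ℤ) (stripYT T) a a)) atTop
      (𝓝 ((ℓ ⬝ᵥ ((Matrix.of fun c d : Fin (2 * T) =>
          ∑' n : ℕ, ∑ l ∈ LMset T n (n : ℤ) (c : ℕ) (d : ℕ), (topCnt T l.tail : ℝ) * wD T (stripYT T) l) *ᵥ u)) /
        (ℓ ⬝ᵥ ((Matrix.of fun a b : Fin (2 * T) => ∑' n : ℕ, (n : ℝ) * LMM T n (n : ℤ) (stripYT T) a b) *ᵥ u)))) := by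
  refine (tendsto_contacts_per_step_pointwise hT hu0 hℓ0 hu hℓ a a).congr fun k => ?_
  obtain ⟨hU, -, hD, -⟩ := hat_contactSlices_eq (stripYT T) k a a
  have hlen : hatLen k a a = ((2 * k : ℕ) : ℤ) := by unfold hatLen; push_cast; ring
  have hnat : (hatLen k a a).toNat = 2 * k := by rw [hlen]; rfl
  rw [hU, hD, hnat]
  congr 2
  rw [hlen]
  norm_cast

end Pointwise

end HV

end Literature.Probability.RandomPlanarGeometry.SAW
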